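import Summits.QuantumFields.BalabanUV.T4Continuum.Support.AlignedCarrierPairing
import Summits.QuantumFields.BalabanUV.T4Continuum.Support.StarCarrierNeumannPairing

/-!
# T⁴ programme, spine node NE2 (U1a), sub-row Δ1 «NE2⁰-Dirichlet» — (P-gaffney) PER COMPONENT: the two-level pairing of ONE component
# of the electric operator on the star carrier, all `d` directions, at rate `N^{−1/2}` against the scalar budgets

NE2 formalisation swarm `b2b-balaban-t4-ne2-formalise-*`, LEAF PROVER 03 (gen 8), item «W3-GAFFNEY-PAIRING» = (P-gaffney) for the
LOCAL operator (owner R35 (c) / O15-c, journal 2026-08-20 l.22128 / l.22472; CLAIM l.22258), file P5a (on P2 `AlignedCarrierPairing`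
p239673 and P3 `StarCarrierNeumannPairing`).

WHAT.  leaf-01-g10's first-order identity (P4b `StarCarrierTwoLevelIdentity.first_order_identity_ite`) writes the owner's (P-W) pairing
`⟨v, (J·W_k − W_{k+1}·J)u⟩` as `Σ_ν [Σ_{μ ≠ ν} ⟨(A_μ − F_μ)z′_ν, ∂_μ z_ν⟩ + ⟨(A_ν − F_ν)z′_ν, bmask z_ν⟩]` with `z_ν = zext ν u`,
`z′_ν = zext ν v` the scalar zero extensions of the components.  THIS FILE bounds ONE component's bracket: the transverse directions by
P2's `pairing_dir_le_starSite` (rate `N⁻¹`, Cauchy–Schwarz over `μ`), the own direction by P3's `neumann_pairing_le` with the wall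
budget `nsq_gV_le` + `walls_le` (rate `N^{−1/2}`), collected against ONE coarse and ONE fine scalar budget per component:
`Bc z = Σ_{μ≠ν} budgetOn_T μ z + gradOn_T ν z + N²·spikeGrad z`, `Bf z′ = Σ_{μ≠ν} budgetOn_{T′} μ z′ + hessN z′ + (2·nsq z′ + gradOn_{T′} ν z′)`.

 * §1 `Bc`, `Bf`, `cGaf R = cDir R + 2 + 2√8·R·√R`;
 * §2 `transverse_sum_le` (P2 + Cauchy–Schwarz), `wall_sqrt_le` (the wall factor `√(nsq gV) ≤ √8·(RN)·√(RN)·√(2nsq z′ + gradOn′)`);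
 * §3 END **`component_pairing_le (hbox) (hz : z ⊂ T_ν) (hz′ : z′ ⊂ T′_ν)`**:
   `‖Σ_{μ≠ν} ⟨(A_μ − F_μ)z′, ∂_μ z⟩ + ⟨(A_ν − F_ν)z′, bmask z⟩‖ ≤ cGaf R·(√N)⁻¹·√Bc z·√Bf z′`.
P5b (the sum over components through P4b and the conversion of `Σ_ν Bc(zext ν u)`, `Σ_ν Bf(zext ν v)` into the owner's `Ebud` by
leaf-02-g8's electric dictionary + the spike rows) closes (P-W) with `εW k = C·(√L)^{−k}`.

HONEST FRAMING (T4-DAG p. 1).  [folklore] bookkeeping; nothing printed is a hypothesis or a conclusion; (P-W) / (L) / `hinjK` / W3 on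
boxes OPEN; NE2 (U1a) NOT proved; spine PROVED 0/9 unchanged; NOT [B9] (3.16)/(3.23)–(3.27) as printed; NOT infinite volume, NOT a mass
gap, NOT the Clay problem, NOT summit progress.  HONEST DEPENDENCY: continuum YM on T⁴ ⇐ BetaPertH ∧ nine spine estimates (0/9 proved);
BetaPertH ⇐ (D1) ∧ (D4) ∧ CAP+tail; G-an2-4 gates asym, D1 and NE2/3/4.  No `sorry`.
-/

noncomputable section

open scoped BigOperators ComplexConjugate Matrix
open Finset

namespace Summit.QuantumFields.BalabanUV.T4Continuum.StarCarrierComponentPairing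

open Literature.MathematicalPhysics.QuantumFieldTheory.Balaban1983to89.B5Prop11Plancherel (Tor fine unitVec)
open Literature.MathematicalPhysics.QuantumFieldTheory.Balaban1983to89.B5Action121 (sdiff)
open Literature.MathematicalPhysics.QuantumFieldTheory.Balaban1983to89.B5Prop11Lower (nsq nsq_nonneg)
open Summit.QuantumFields.BalabanUV.Beta.GAN24.DirichletBoxPairing (Aop Fop)
open Summit.QuantumFields.BalabanUV.Beta.GAN24.DirichletBoxTwoLevel (cDir cDir_nonneg IsCoordBox)
open Summit.QuantumFields.BalabanUV.T4Continuum.AlignedCarrierTrace (starSite)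
open Summit.QuantumFields.BalabanUV.T4Continuum.AlignedCarrierPairing (budgetOn budgetOn_nonneg pairing_dir_le_starSite)
open Summit.QuantumFields.BalabanUV.T4Continuum.CarrierColumnTrace (gradOn gradOn_nonneg)
open Summit.QuantumFields.BalabanUV.T4Continuum.StarCarrierNeumannPairing (bmask hessN spikeGrad gV wallUp wallDn nsq_gV_le walls_le
  neumann_pairing_le)

variable {d : ℕ} (N R : ℕ) [NeZero N] [NeZero R] (M : Fin d → ℕ) [hM : ∀ μ, NeZero (M μ)] (S : Tor M → Prop) [DecidablePred S]
  (ν : Fin d)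

/-! ## §1 The per-component budgets and the constant -/

/-- the COARSE per-component budget: transverse gan24 budgets + own-direction masked gradient + the spike rows `N²·spikeGrad`. [folklore] -/
def Bc (z : Tor (fine N M) → ℂ) : ℝ :=
  (∑ μ ∈ univ.erase ν, budgetOn N M (starSite N M S ν) μ z) + gradOn N M (starSite N M S ν) ν z + (N : ℝ) ^ 2 * spikeGrad N M S ν z

/-- the FINE per-component budget: transverse gan24 budgets + Neumann Hessian + (mass + own-direction gradient) for the walls. [folklore] -/
def Bf (z' : Tor (fine (R * N) M) → ℂ) : ℝ :=
  (∑ μ ∈ univ.erase ν, budgetOn (R * N) M (starSite (R * N) M S ν) μ z') + hessN N R M S ν z'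
    + (2 * nsq z' + gradOn (R * N) M (starSite (R * N) M S ν) ν z')

/-- the per-component constant `cDir R + 2 + 2√8·R·√R`. [folklore] -/
def cGaf (R : ℕ) : ℝ := cDir R + 2 + 2 * Real.sqrt 8 * (R : ℝ) * Real.sqrt R

omit [NeZero R] in
/-- `0 ≤ cGaf`. [folklore] -/
theorem cGaf_nonneg : 0 ≤ cGaf R := by
  unfold cGaf; have := cDir_nonneg R; positivity

/-- `hessN ≥ 0`. [folklore] -/
theorem hessN_nonneg (z' : Tor (fine (R * N) M) → ℂ) : 0 ≤ hessN N R M S ν z' := Finset.sum_nonneg fun _ _ => sq_nonneg _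

omit [NeZero R] in
/-- `spikeGrad ≥ 0`. [folklore] -/
theorem spikeGrad_nonneg (z : Tor (fine N M) → ℂ) : 0 ≤ spikeGrad N M S ν z := nsq_nonneg _

omit [NeZero R] in
/-- `Bc ≥ 0`. [folklore] -/
theorem Bc_nonneg (z : Tor (fine N M) → ℂ) : 0 ≤ Bc N M S ν z := by
  unfold Bc
  have h1 : 0 ≤ ∑ μ ∈ univ.erase ν, budgetOn N M (starSite N M S ν) μ z := Finset.sum_nonneg fun μ _ => budgetOn_nonneg _ _ _ _ _
  have h2 := gradOn_nonneg N M (starSite N M S ν) ν z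
  have h3 := spikeGrad_nonneg N M S ν z
  positivity

/-- `Bf ≥ 0`. [folklore] -/
theorem Bf_nonneg (z' : Tor (fine (R * N) M) → ℂ) : 0 ≤ Bf N R M S ν z' := by
  unfold Bf
  have h1 : 0 ≤ ∑ μ ∈ univ.erase ν, budgetOn (R * N) M (starSite (R * N) M S ν) μ z' :=
    Finset.sum_nonneg fun μ _ => budgetOn_nonneg _ _ _ _ _
  have h2 := hessN_nonneg N R M S ν z'
  have h3 := gradOn_nonneg (R * N) M (starSite (R * N) M S ν) ν z'
  have h4 := nsq_nonneg z'
  positivity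

/-! ## §2 The transverse sum and the wall factor -/

/-- **THE TRANSVERSE DIRECTIONS, SUMMED** (P2 per `μ ≠ ν` + Cauchy–Schwarz over `μ`). [folklore] -/
theorem transverse_sum_le (hbox : IsCoordBox M S) {z : Tor (fine N M) → ℂ} (hz : ∀ x, ¬ starSite N M S ν x → z x = 0)
    {z' : Tor (fine (R * N) M) → ℂ} (hz' : ∀ x, ¬ starSite (R * N) M S ν x → z' x = 0) :
    ∑ μ ∈ univ.erase ν, ‖star ((Aop N R M μ - Fop N R M μ) *ᵥ z') ⬝ᵥ (sdiff (fine N M) (N : ℂ) μ *ᵥ z)‖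
      ≤ cDir R / N * (Real.sqrt (∑ μ ∈ univ.erase ν, budgetOn N M (starSite N M S ν) μ z)
          * Real.sqrt (∑ μ ∈ univ.erase ν, budgetOn (R * N) M (starSite (R * N) M S ν) μ z')) := by
  have hNpos : (0 : ℝ) < N := by exact_mod_cast Nat.pos_of_ne_zero (NeZero.ne N)
  have hc : 0 ≤ cDir R / N := div_nonneg (cDir_nonneg R) hNpos.le
  have h1 : ∑ μ ∈ univ.erase ν, ‖star ((Aop N R M μ - Fop N R M μ) *ᵥ z') ⬝ᵥ (sdiff (fine N M) (N : ℂ) μ *ᵥ z)‖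
      ≤ ∑ μ ∈ univ.erase ν, cDir R / N * (Real.sqrt (budgetOn N M (starSite N M S ν) μ z)
          * Real.sqrt (budgetOn (R * N) M (starSite (R * N) M S ν) μ z')) :=
    Finset.sum_le_sum fun μ hμ => pairing_dir_le_starSite N R M S hbox (Finset.ne_of_mem_erase hμ) hz hz'
  rw [← Finset.mul_sum] at h1
  refine h1.trans (mul_le_mul_of_nonneg_left ?_ hc)
  exact Real.sum_sqrt_mul_sqrt_le _ (fun μ => budgetOn_nonneg _ _ _ _ _) (fun μ => budgetOn_nonneg _ _ _ _ _)

/-- `√(c³·X)`-type algebra: `√(c²·c) = c·√c` for `c ≥ 0`. [folklore] -/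
theorem sqrt_cube {c : ℝ} (hc : 0 ≤ c) : Real.sqrt (c ^ 3) = c * Real.sqrt c := by
  rw [show c ^ 3 = c ^ 2 * c by ring, Real.sqrt_mul (sq_nonneg c), Real.sqrt_sq hc]

/-- **THE WALL FACTOR**: `√(nsq gV z′) ≤ √8·(RN)·√(RN)·√(2·nsq z′ + gradOn′ z′)` (P3's `nsq_gV_le` + `walls_le`). [folklore] -/
theorem wall_sqrt_le {z' : Tor (fine (R * N) M) → ℂ} (hz' : ∀ x, ¬ starSite (R * N) M S ν x → z' x = 0) :
    Real.sqrt (nsq (gV N R M S ν z'))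
      ≤ Real.sqrt 8 * (((R * N : ℕ) : ℝ) * Real.sqrt ((R * N : ℕ) : ℝ))
          * Real.sqrt (2 * nsq z' + gradOn (R * N) M (starSite (R * N) M S ν) ν z') := by
  set c : ℝ := ((R * N : ℕ) : ℝ) with hc
  have hcpos : 0 < c := by rw [hc]; exact_mod_cast Nat.pos_of_ne_zero (NeZero.ne (R * N))
  set X : ℝ := 2 * nsq z' + gradOn (R * N) M (starSite (R * N) M S ν) ν z' with hX
  have hX0 : 0 ≤ X := by rw [hX]; have := nsq_nonneg z'; have := gradOn_nonneg (R * N) M (starSite (R * N) M S ν) ν z'; positivity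
  have h1 := nsq_gV_le N R M S ν hz'
  have h2 := walls_le N R M S ν z'
  have hW0 : 0 ≤ wallUp N R M S ν z' + wallDn N R M S ν z' :=
    add_nonneg (Finset.sum_nonneg fun _ _ => sq_nonneg _) (Finset.sum_nonneg fun _ _ => sq_nonneg _)
  -- `nsq gV ≤ 4c⁴·W ≤ 8c³·X` since `c·W ≤ 2X`
  have h3 : nsq (gV N R M S ν z') ≤ 8 * c ^ 3 * X := by
    have : 4 * c ^ 4 * (wallUp N R M S ν z' + wallDn N R M S ν z') = 4 * c ^ 3 * (c * (wallUp N R M S ν z' + wallDn N R M S ν z')) := by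
      ring
    rw [this] at h1
    have h4 : 4 * c ^ 3 * (c * (wallUp N R M S ν z' + wallDn N R M S ν z')) ≤ 4 * c ^ 3 * (2 * X) :=
      mul_le_mul_of_nonneg_left h2 (by positivity)
    linarith
  calc Real.sqrt (nsq (gV N R M S ν z')) ≤ Real.sqrt (8 * c ^ 3 * X) := Real.sqrt_le_sqrt h3
    _ = Real.sqrt 8 * (c * Real.sqrt c) * Real.sqrt X := by
        rw [Real.sqrt_mul (by positivity) X, Real.sqrt_mul (by norm_num) (c ^ 3), sqrt_cube hcpos.le]

/-! ## §3 The END: one component, all directions -/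

/-- **(P-gaffney) PER COMPONENT**: for `z` vanishing off the coarse star carrier `T_ν` and `z′` vanishing off the fine one,
`‖Σ_{μ≠ν} ⟨(A_μ − F_μ)z′, ∂_μ z⟩ + ⟨(A_ν − F_ν)z′, bmask z⟩‖ ≤ cGaf R·(√N)⁻¹·√Bc z·√Bf z′`. [folklore] -/
theorem component_pairing_le (hbox : IsCoordBox M S) {z : Tor (fine N M) → ℂ} (hz : ∀ x, ¬ starSite N M S ν x → z x = 0)
    {z' : Tor (fine (R * N) M) → ℂ} (hz' : ∀ x, ¬ starSite (R * N) M S ν x → z' x = 0) :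
    ‖(∑ μ ∈ univ.erase ν, star ((Aop N R M μ - Fop N R M μ) *ᵥ z') ⬝ᵥ (sdiff (fine N M) (N : ℂ) μ *ᵥ z))
        + star ((Aop N R M ν - Fop N R M ν) *ᵥ z') ⬝ᵥ (bmask N M S ν z)‖
      ≤ cGaf R * (Real.sqrt N)⁻¹ * (Real.sqrt (Bc N M S ν z) * Real.sqrt (Bf N R M S ν z')) := by
  have hNpos : (0 : ℝ) < N := by exact_mod_cast Nat.pos_of_ne_zero (NeZero.ne N)
  have hRpos : (0 : ℝ) < R := by exact_mod_cast Nat.pos_of_ne_zero (NeZero.ne R)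
  have hs : 0 < Real.sqrt N := Real.sqrt_pos.mpr hNpos
  have hsN : Real.sqrt N * Real.sqrt N = N := Real.mul_self_sqrt hNpos.le
  have hN1 : (1 : ℝ) ≤ N := by exact_mod_cast Nat.pos_of_ne_zero (NeZero.ne N)
  have hinv : (1 : ℝ) / N ≤ (Real.sqrt N)⁻¹ := by
    rw [one_div]
    refine inv_anti₀ hs ?_
    calc Real.sqrt N ≤ Real.sqrt ((N : ℝ) ^ 2) := Real.sqrt_le_sqrt (by nlinarith)
      _ = N := Real.sqrt_sq hNpos.le
  -- abbreviations
  set a := ∑ μ ∈ univ.erase ν, budgetOn N M (starSite N M S ν) μ z with ha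
  set a' := ∑ μ ∈ univ.erase ν, budgetOn (R * N) M (starSite (R * N) M S ν) μ z' with ha'
  set g := gradOn N M (starSite N M S ν) ν z with hg
  set sp := spikeGrad N M S ν z with hsp
  set h' := hessN N R M S ν z' with hh'
  set X := 2 * nsq z' + gradOn (R * N) M (starSite (R * N) M S ν) ν z' with hX
  have ha0 : 0 ≤ a := Finset.sum_nonneg fun μ _ => budgetOn_nonneg _ _ _ _ _
  have ha'0 : 0 ≤ a' := Finset.sum_nonneg fun μ _ => budgetOn_nonneg _ _ _ _ _
  have hg0 : 0 ≤ g := gradOn_nonneg _ _ _ _ _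
  have hsp0 : 0 ≤ sp := nsq_nonneg _
  have hh'0 : 0 ≤ h' := Finset.sum_nonneg fun _ _ => sq_nonneg _
  have hX0 : 0 ≤ X := by
    rw [hX]; have := nsq_nonneg z'; have := gradOn_nonneg (R * N) M (starSite (R * N) M S ν) ν z'; positivity
  -- every square root is below the budget root
  have hBc : Bc N M S ν z = a + g + (N : ℝ) ^ 2 * sp := rfl
  have hBf : Bf N R M S ν z' = a' + h' + X := rfl
  have ra : Real.sqrt a ≤ Real.sqrt (Bc N M S ν z) := Real.sqrt_le_sqrt (by rw [hBc]; nlinarith)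
  have rg : Real.sqrt g ≤ Real.sqrt (Bc N M S ν z) := Real.sqrt_le_sqrt (by rw [hBc]; nlinarith)
  have rsp : Real.sqrt sp * N ≤ Real.sqrt (Bc N M S ν z) := by
    rw [← Real.sqrt_sq hNpos.le, ← Real.sqrt_mul hsp0]
    exact Real.sqrt_le_sqrt (by rw [hBc]; nlinarith)
  have ra' : Real.sqrt a' ≤ Real.sqrt (Bf N R M S ν z') := Real.sqrt_le_sqrt (by rw [hBf]; linarith)
  have rh' : Real.sqrt h' ≤ Real.sqrt (Bf N R M S ν z') := Real.sqrt_le_sqrt (by rw [hBf]; linarith)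
  have rX : Real.sqrt X ≤ Real.sqrt (Bf N R M S ν z') := Real.sqrt_le_sqrt (by rw [hBf]; linarith)
  set P := Real.sqrt (Bc N M S ν z) with hP
  set Q := Real.sqrt (Bf N R M S ν z') with hQ
  have hP0 : 0 ≤ P := Real.sqrt_nonneg _
  have hQ0 : 0 ≤ Q := Real.sqrt_nonneg _
  -- the three pieces
  have hT := transverse_sum_le N R M S ν hbox hz hz'
  have hNe := neumann_pairing_le N R M S ν z' z
  have hW := wall_sqrt_le N R M S ν hz'
  -- transverse: `(cDir R / N)·√a·√a′ ≤ (cDir R / √N)·P·Q`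
  have t1 : cDir R / N * (Real.sqrt a * Real.sqrt a') ≤ cDir R * (Real.sqrt N)⁻¹ * (P * Q) := by
    have hab : Real.sqrt a * Real.sqrt a' ≤ P * Q := mul_le_mul ra ra' (Real.sqrt_nonneg _) hP0
    calc cDir R / N * (Real.sqrt a * Real.sqrt a') = cDir R * (1 / N) * (Real.sqrt a * Real.sqrt a') := by ring
      _ ≤ cDir R * (Real.sqrt N)⁻¹ * (P * Q) :=
          mul_le_mul (mul_le_mul_of_nonneg_left hinv (cDir_nonneg R)) hab (by positivity)
            (mul_nonneg (cDir_nonneg R) (inv_nonneg.mpr hs.le))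
  -- Neumann interior: `(2/N)·√h′·√g ≤ 2·(√N)⁻¹·P·Q`
  have t2 : 2 / (N : ℝ) * (Real.sqrt h' * Real.sqrt g) ≤ 2 * (Real.sqrt N)⁻¹ * (P * Q) := by
    have hab : Real.sqrt h' * Real.sqrt g ≤ P * Q := by
      rw [mul_comm]; exact mul_le_mul rg rh' (Real.sqrt_nonneg _) hP0
    calc 2 / (N : ℝ) * (Real.sqrt h' * Real.sqrt g) = 2 * (1 / N) * (Real.sqrt h' * Real.sqrt g) := by ring
      _ ≤ 2 * (Real.sqrt N)⁻¹ * (P * Q) :=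
          mul_le_mul (mul_le_mul_of_nonneg_left hinv (by norm_num)) hab (by positivity) (by positivity)
  -- wall: `(2/N)·√(nsq gV)·√sp ≤ 2√8·R·√R·(√N)⁻¹·P·Q`
  have t3 : 2 / (N : ℝ) * (Real.sqrt (nsq (gV N R M S ν z')) * Real.sqrt sp)
      ≤ 2 * Real.sqrt 8 * (R : ℝ) * Real.sqrt R * (Real.sqrt N)⁻¹ * (P * Q) := by
    have hcRN : ((R * N : ℕ) : ℝ) = (R : ℝ) * N := by push_cast; ring
    have hsRN : Real.sqrt ((R * N : ℕ) : ℝ) = Real.sqrt R * Real.sqrt N := by rw [hcRN, Real.sqrt_mul hRpos.le]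
    -- `√(nsq gV)·√sp ≤ √8·(RN)·√(RN)·√X·√sp` and `√X ≤ Q`, `√sp·N ≤ P`
    have w1 : Real.sqrt (nsq (gV N R M S ν z')) * Real.sqrt sp
        ≤ Real.sqrt 8 * ((R : ℝ) * N * (Real.sqrt R * Real.sqrt N)) * Q * Real.sqrt sp := by
      have := mul_le_mul_of_nonneg_right hW (Real.sqrt_nonneg sp)
      rw [hsRN, hcRN] at this
      refine this.trans ?_
      have hq : Real.sqrt X ≤ Q := rX
      exact mul_le_mul_of_nonneg_right (mul_le_mul_of_nonneg_left hq (by positivity)) (Real.sqrt_nonneg _)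
    -- reorganise: `(2/N)·√8·R·N·√R·√N·Q·√sp = 2√8·R·√R·(√N)⁻¹·Q·(√sp·N)` using `N·√N/N = √N = N·(√N)⁻¹`
    have e1 : 2 / (N : ℝ) * (Real.sqrt 8 * ((R : ℝ) * N * (Real.sqrt R * Real.sqrt N)) * Q * Real.sqrt sp)
        = 2 * Real.sqrt 8 * (R : ℝ) * Real.sqrt R * (Real.sqrt N)⁻¹ * (Q * (Real.sqrt sp * N)) := by
      have hN0 : (N : ℝ) ≠ 0 := hNpos.ne'
      rw [← Real.sqrt_div_self]
      field_simp
    calc 2 / (N : ℝ) * (Real.sqrt (nsq (gV N R M S ν z')) * Real.sqrt sp)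
        ≤ 2 / (N : ℝ) * (Real.sqrt 8 * ((R : ℝ) * N * (Real.sqrt R * Real.sqrt N)) * Q * Real.sqrt sp) :=
          mul_le_mul_of_nonneg_left w1 (by positivity)
      _ = 2 * Real.sqrt 8 * (R : ℝ) * Real.sqrt R * (Real.sqrt N)⁻¹ * (Q * (Real.sqrt sp * N)) := e1
      _ ≤ 2 * Real.sqrt 8 * (R : ℝ) * Real.sqrt R * (Real.sqrt N)⁻¹ * (Q * P) :=
          mul_le_mul_of_nonneg_left (mul_le_mul_of_nonneg_left rsp hQ0) (by positivity)
      _ = 2 * Real.sqrt 8 * (R : ℝ) * Real.sqrt R * (Real.sqrt N)⁻¹ * (P * Q) := by ring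
  -- assemble
  calc ‖(∑ μ ∈ univ.erase ν, star ((Aop N R M μ - Fop N R M μ) *ᵥ z') ⬝ᵥ (sdiff (fine N M) (N : ℂ) μ *ᵥ z))
          + star ((Aop N R M ν - Fop N R M ν) *ᵥ z') ⬝ᵥ (bmask N M S ν z)‖
      ≤ ‖∑ μ ∈ univ.erase ν, star ((Aop N R M μ - Fop N R M μ) *ᵥ z') ⬝ᵥ (sdiff (fine N M) (N : ℂ) μ *ᵥ z)‖
          + ‖star ((Aop N R M ν - Fop N R M ν) *ᵥ z') ⬝ᵥ (bmask N M S ν z)‖ := norm_add_le _ _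
    _ ≤ (∑ μ ∈ univ.erase ν, ‖star ((Aop N R M μ - Fop N R M μ) *ᵥ z') ⬝ᵥ (sdiff (fine N M) (N : ℂ) μ *ᵥ z)‖)
          + ‖star ((Aop N R M ν - Fop N R M ν) *ᵥ z') ⬝ᵥ (bmask N M S ν z)‖ :=
          add_le_add (norm_sum_le _ _) le_rfl
    _ ≤ cDir R / N * (Real.sqrt a * Real.sqrt a')
          + 2 / (N : ℝ) * (Real.sqrt h' * Real.sqrt g + Real.sqrt (nsq (gV N R M S ν z')) * Real.sqrt sp) := add_le_add hT hNe
    _ = cDir R / N * (Real.sqrt a * Real.sqrt a') + 2 / (N : ℝ) * (Real.sqrt h' * Real.sqrt g)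
          + 2 / (N : ℝ) * (Real.sqrt (nsq (gV N R M S ν z')) * Real.sqrt sp) := by ring
    _ ≤ cDir R * (Real.sqrt N)⁻¹ * (P * Q) + 2 * (Real.sqrt N)⁻¹ * (P * Q)
          + 2 * Real.sqrt 8 * (R : ℝ) * Real.sqrt R * (Real.sqrt N)⁻¹ * (P * Q) := add_le_add (add_le_add t1 t2) t3
    _ = cGaf R * (Real.sqrt N)⁻¹ * (P * Q) := by rw [cGaf]; ring

end Summit.QuantumFields.BalabanUV.T4Continuum.StarCarrierComponentPairing

end
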